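import Summits.QuantumFields.YangMills.Theorems.UnitScaleTiltProp7MassivePropagatorAgmonLetters
import Summits.QuantumFields.YangMills.Theorems.UnitScaleTiltProp8ChartTransport
import HarnessLib

/-!
# Route `UnitScaleTilt`, crux K1 «MinimiserStabilityRegPr» (stmt-QuantumFields-19200), EX row `hGF[Lift]` (curved member) — **LOD LINE, PEN (L5″) (M-III′):
# THE CORNER-COMB FRAME ROWS** — the geometric hypotheses `hCV`∕`hCU` of the δ_Q supplier `Prop7TopMeanTwoBackgrounds` (px5, (M-III)): the ROW-T corner-comb frame
`C^W_{K−n,Y,x} = (axialT W♭ (corner Y) (embIter (K−n) Y))⁻¹·axialT W♭ (corner Y) x` (the `set C` of ✓`Prop7MassivePropagatorAgmonLetters.norm_nsTop_le_of_regPr` VERBATIM) is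
`= 1` at the flat background (§2) and `8mδ′`-close to `1` when `W♭` is `δ′`-flat on the two axial comb walks from the corner (lengths `≤ m`, `4mδ′ ≤ 1`; §3, the walk bound
✓`Prop8Chart.norm_holT_sub_one_sub_walkSum_le_of_length_le`).

Cell `ym3-torus` (HUMAN RULING D-0037, YM ladder rung R3 — NOT d = 4, NOT infinite volume, NOT a mass gap, NOT Clay).  Width seat `ym3-torus-px5` gen 11; ★p1 g24 LOCATE-L6-ASSEMBLY
§1 Step I.2 (L5″), road (α).  THEOREMS ONLY (0 `def`, 0 `sorry`); `--supports stmt-QuantumFields-19200 --as helper`, count-neutral.  HONEST LABEL (★★OWNER RULING №33 (6)): curved γ-row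
supplier line (LOD localisation), pen (L5″); elementary transport algebra — what stays for the consumer is only WHICH bonds the two comb walks visit (lattice geometry of `treeWord`);
nothing of (3.49), Thm 3.1∕3.3, `h349`, `hGF`, EX ∕ 19200 is proved here.

References: T. Bałaban, CMP **98** (1985) 17–51 [Balaban1985Averaging] ((19)–(20) p.21, p.24); CMP **102** (1985) 255–275 [Balaban1985UV3] ((27) p.263);
CMP **99** (1985) 389–434 [Balaban1985BackgroundPropagators] ((3.19) p.393).
-/

set_option autoImplicit false

noncomputable section

open scoped BigOperators Matrix.Norms.L2Operator

namespace Summit.QuantumFields.YangMills.Theorems.Prop7TopMeanFrameRows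

open Literature.MathematicalPhysics.QuantumFieldTheory.Balaban1983to89
open T4Continuum BlockAveraging
open B7Prop1Explicit (U1 mem_U1 treeWord l1 length_treeWord norm_inv_sub_one_le)
open B5Eq118OneStroke (iterBlockOf iterBlock)
open B15DeterminingSets (embIter)
open B10Eq27TorusAxialLog (holT axialT rel holT_one unitsField toUField)
open Literature.MathematicalPhysics.QuantumFieldTheory.Balaban1983to89.T3ContinuumYM3Torus
open T3SectALandauChart (bgUnits)
open Summit.QuantumFields.YangMills.Theorems.Prop7SymAvgTwSym (holT_mem_U1 unitsField_toUField_mem_U1')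
open Summit.QuantumFields.YangMills.Theorems.Prop8Chart (norm_holT_sub_one_sub_walkSum_le_of_length_le)

variable (F : T3Family) {n K : ℕ}

/-! ## §1 Two units near `1` have a quotient near `1` -/

/-- `‖A⁻¹B − 1‖ ≤ ‖A − 1‖ + ‖B − 1‖` for `A ∈ U1` (`A⁻¹B − 1 = A⁻¹(B − 1) + (A⁻¹ − 1)`, `‖A⁻¹‖ ≤ 1`, `‖A⁻¹ − 1‖ ≤ ‖A − 1‖`). [folklore] [cite: Balaban1985Averaging, (19)-(20) p.21] -/
theorem norm_inv_mul_sub_one_le {A B : (Matrix (Fin 2) (Fin 2) ℂ)ˣ} (hA : A ∈ U1 (Matrix (Fin 2) (Fin 2) ℂ)) :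
    ‖((A⁻¹ * B : (Matrix (Fin 2) (Fin 2) ℂ)ˣ) : Matrix (Fin 2) (Fin 2) ℂ) - 1‖ ≤ ‖(A : Matrix (Fin 2) (Fin 2) ℂ) - 1‖ + ‖(B : Matrix (Fin 2) (Fin 2) ℂ) - 1‖ := by
  have hA2 : ‖((A⁻¹ : (Matrix (Fin 2) (Fin 2) ℂ)ˣ) : Matrix (Fin 2) (Fin 2) ℂ)‖ ≤ 1 := (mem_U1.mp hA).2
  have hinv : ‖((A⁻¹ : (Matrix (Fin 2) (Fin 2) ℂ)ˣ) : Matrix (Fin 2) (Fin 2) ℂ) - 1‖ ≤ ‖(A : Matrix (Fin 2) (Fin 2) ℂ) - 1‖ := norm_inv_sub_one_le hA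
  have e : ((A⁻¹ * B : (Matrix (Fin 2) (Fin 2) ℂ)ˣ) : Matrix (Fin 2) (Fin 2) ℂ) - 1 = ((A⁻¹ : (Matrix (Fin 2) (Fin 2) ℂ)ˣ) : Matrix (Fin 2) (Fin 2) ℂ) * ((B : Matrix (Fin 2) (Fin 2) ℂ) - 1) + (((A⁻¹ : (Matrix (Fin 2) (Fin 2) ℂ)ˣ) : Matrix (Fin 2) (Fin 2) ℂ) - 1) := by
    rw [Units.val_mul]; simp only [mul_sub, mul_one]; abel
  rw [e]
  calc ‖((A⁻¹ : (Matrix (Fin 2) (Fin 2) ℂ)ˣ) : Matrix (Fin 2) (Fin 2) ℂ) * ((B : Matrix (Fin 2) (Fin 2) ℂ) - 1) + (((A⁻¹ : (Matrix (Fin 2) (Fin 2) ℂ)ˣ) : Matrix (Fin 2) (Fin 2) ℂ) - 1)‖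
      ≤ ‖((A⁻¹ : (Matrix (Fin 2) (Fin 2) ℂ)ˣ) : Matrix (Fin 2) (Fin 2) ℂ)‖ * ‖(B : Matrix (Fin 2) (Fin 2) ℂ) - 1‖ + ‖((A⁻¹ : (Matrix (Fin 2) (Fin 2) ℂ)ˣ) : Matrix (Fin 2) (Fin 2) ℂ) - 1‖ := (norm_add_le _ _).trans (add_le_add (norm_mul_le _ _) le_rfl)
    _ ≤ 1 * ‖(B : Matrix (Fin 2) (Fin 2) ℂ) - 1‖ + ‖(A : Matrix (Fin 2) (Fin 2) ℂ) - 1‖ := by gcongr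
    _ = ‖(A : Matrix (Fin 2) (Fin 2) ℂ) - 1‖ + ‖(B : Matrix (Fin 2) (Fin 2) ℂ) - 1‖ := by ring

/-! ## §2 The flat background: every corner-comb frame is `1` -/

/-- At `U₀ = 1` the units background is the trivial configuration, so every axial transport is `1` (✓`holT_one`). [cite: Balaban1985UV3, (27) p.263; Balaban1985Averaging, (19) p.21] -/
theorem axialT_bgUnits_one (z x : Site (F.P K) 0) :
    axialT (bgUnits F K (1 : GaugeField (F.P K) 0 (Matrix.specialUnitaryGroup (Fin 2) ℂ))) z x = 1 := by
  have hb : bgUnits F K (1 : GaugeField (F.P K) 0 (Matrix.specialUnitaryGroup (Fin 2) ℂ)) = fun _ => 1 :=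
    T3PrintedRegularMinimiser.unitsField_toUField_one
  unfold axialT
  rw [hb, holT_one]

/-- ★ **THE FLAT FRAME ROW** (`hCV` of ✓`Prop7TopMeanTwoBackgrounds.norm_lift_topMean_sub_le` at `V := 1`, with `δ_V = 0`): for every top block `Y` and every `x`,
`‖C^1_{K−n,Y,x} − 1‖ ≤ 0`. [cite: Balaban1985Averaging, (19)-(20) p.21, p.24] -/
theorem norm_frame_one_sub_one_le (Y : Site (F.P K) (K - n)) (x : Site (F.P K) 0) :
    ‖(((axialT (bgUnits F K (1 : GaugeField (F.P K) 0 (Matrix.specialUnitaryGroup (Fin 2) ℂ))) (Site.fibreSite 0 (K - n) (iterBlockOf (K - n) x) fun _ => (⟨0, pow_pos (F.P K).L_pos (K - n)⟩ : Fin ((F.P K).L ^ (K - n)))) (embIter (K - n) Y))⁻¹ *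
          axialT (bgUnits F K (1 : GaugeField (F.P K) 0 (Matrix.specialUnitaryGroup (Fin 2) ℂ))) (Site.fibreSite 0 (K - n) (iterBlockOf (K - n) x) fun _ => (⟨0, pow_pos (F.P K).L_pos (K - n)⟩ : Fin ((F.P K).L ^ (K - n)))) x : (Matrix (Fin 2) (Fin 2) ℂ)ˣ) : Matrix (Fin 2) (Fin 2) ℂ) - 1‖ ≤ 0 := by
  rw [axialT_bgUnits_one, axialT_bgUnits_one, inv_one, mul_one, Units.val_one, sub_self, norm_zero]

/-- The flat frame row in the exact shape consumed by ✓`Prop7TopMeanTwoBackgrounds.norm_lift_topMean_sub_le`∕`norm_inner_lift_topMean_sub_le` (any cut-off `χ`, `δ_V := 0`).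
[cite: Balaban1985Averaging, (19)-(20) p.21, p.24] -/
theorem frameRow_one (χ : Site (F.P K) 0 → ℝ) :
    ∀ Y : Site (F.P K) (K - n), (∃ x ∈ iterBlock (K - n) Y, χ x ≠ 0) → ∀ x ∈ iterBlock (K - n) Y,
      ‖(((axialT (bgUnits F K (1 : GaugeField (F.P K) 0 (Matrix.specialUnitaryGroup (Fin 2) ℂ))) (Site.fibreSite 0 (K - n) (iterBlockOf (K - n) x) fun _ => (⟨0, pow_pos (F.P K).L_pos (K - n)⟩ : Fin ((F.P K).L ^ (K - n)))) (embIter (K - n) Y))⁻¹ *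
          axialT (bgUnits F K (1 : GaugeField (F.P K) 0 (Matrix.specialUnitaryGroup (Fin 2) ℂ))) (Site.fibreSite 0 (K - n) (iterBlockOf (K - n) x) fun _ => (⟨0, pow_pos (F.P K).L_pos (K - n)⟩ : Fin ((F.P K).L ^ (K - n)))) x : (Matrix (Fin 2) (Fin 2) ℂ)ˣ) : Matrix (Fin 2) (Fin 2) ℂ) - 1‖ ≤ (0 : ℝ) :=
  fun Y _ x _ => norm_frame_one_sub_one_le F Y x

/-! ## §3 A background flat on the two comb walks: the frame is near `1` -/

/-- ★ **THE AXIAL TRANSPORT OF A WALK-FLAT BACKGROUND IS NEAR `1`**: if `‖W♭(b) − 1‖ ≤ δ′` on every bond of the axial comb walk from `z` to `x` (word `treeWord (rel z x)`, length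
`l1 (rel z x) ≤ m`, `1 ≤ m`, `4mδ′ ≤ 1`), then `‖axialT W♭ z x − 1‖ ≤ 4mδ′` (✓`Prop8Chart.norm_holT_sub_one_sub_walkSum_le_of_length_le`). [cite: Balaban1985Averaging, p.24, (19)-(20) p.21] -/
theorem norm_axialT_bgUnits_sub_one_le (W : GaugeField (F.P K) 0 (Matrix.specialUnitaryGroup (Fin 2) ℂ)) (z x : Site (F.P K) 0)
    {δ' : ℝ} (hδ : 0 ≤ δ') {m : ℕ} (hm1 : 1 ≤ m) (hmδ : 4 * (m : ℝ) * δ' ≤ 1) (hlen : l1 (rel z x) ≤ m)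
    (hw : ∀ st ∈ walk z (treeWord (rel z x)), ‖((bgUnits F K W st.bond : (Matrix (Fin 2) (Fin 2) ℂ)ˣ) : Matrix (Fin 2) (Fin 2) ℂ) - 1‖ ≤ δ') :
    ‖((axialT (bgUnits F K W) z x : (Matrix (Fin 2) (Fin 2) ℂ)ˣ) : Matrix (Fin 2) (Fin 2) ℂ) - 1‖ ≤ 4 * m * δ' := by
  unfold axialT
  exact (norm_holT_sub_one_sub_walkSum_le_of_length_le hδ hm1 hmδ (treeWord (rel z x)) z
    (by rw [length_treeWord]; exact hlen) hw).1

/-- ★★ **THE CURVED FRAME ROW** (`hCU` of ✓`Prop7TopMeanTwoBackgrounds.norm_lift_topMean_sub_le`, one block∕site at a time): if `W♭ = bgUnits F K W` is `δ′`-flat on the bonds of the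
two axial comb walks from the corner of `B^{K−n}(x)` — to `x` and to the block's base point `embIter (K−n) Y` — (lengths `≤ m`, `1 ≤ m`, `4mδ′ ≤ 1`), then
`‖C^W_{K−n,Y,x} − 1‖ ≤ 8mδ′` (§1 + ✓`norm_axialT_bgUnits_sub_one_le` twice; `axialT W♭ ∈ U1`). [cite: Balaban1985Averaging, (19)-(20) p.21, p.24; Balaban1985BackgroundPropagators, (3.19) p.393] -/
theorem norm_frame_sub_one_le (W : GaugeField (F.P K) 0 (Matrix.specialUnitaryGroup (Fin 2) ℂ)) (Y : Site (F.P K) (K - n)) (x : Site (F.P K) 0)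
    {δ' : ℝ} (hδ : 0 ≤ δ') {m : ℕ} (hm1 : 1 ≤ m) (hmδ : 4 * (m : ℝ) * δ' ≤ 1)
    (hlen1 : l1 (rel (Site.fibreSite 0 (K - n) (iterBlockOf (K - n) x) fun _ => (⟨0, pow_pos (F.P K).L_pos (K - n)⟩ : Fin ((F.P K).L ^ (K - n)))) (embIter (K - n) Y)) ≤ m)
    (hlen2 : l1 (rel (Site.fibreSite 0 (K - n) (iterBlockOf (K - n) x) fun _ => (⟨0, pow_pos (F.P K).L_pos (K - n)⟩ : Fin ((F.P K).L ^ (K - n)))) x) ≤ m)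
    (hw1 : ∀ st ∈ walk (Site.fibreSite 0 (K - n) (iterBlockOf (K - n) x) fun _ => (⟨0, pow_pos (F.P K).L_pos (K - n)⟩ : Fin ((F.P K).L ^ (K - n)))) (treeWord (rel (Site.fibreSite 0 (K - n) (iterBlockOf (K - n) x) fun _ => (⟨0, pow_pos (F.P K).L_pos (K - n)⟩ : Fin ((F.P K).L ^ (K - n)))) (embIter (K - n) Y))),
      ‖((bgUnits F K W st.bond : (Matrix (Fin 2) (Fin 2) ℂ)ˣ) : Matrix (Fin 2) (Fin 2) ℂ) - 1‖ ≤ δ')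
    (hw2 : ∀ st ∈ walk (Site.fibreSite 0 (K - n) (iterBlockOf (K - n) x) fun _ => (⟨0, pow_pos (F.P K).L_pos (K - n)⟩ : Fin ((F.P K).L ^ (K - n)))) (treeWord (rel (Site.fibreSite 0 (K - n) (iterBlockOf (K - n) x) fun _ => (⟨0, pow_pos (F.P K).L_pos (K - n)⟩ : Fin ((F.P K).L ^ (K - n)))) x)),
      ‖((bgUnits F K W st.bond : (Matrix (Fin 2) (Fin 2) ℂ)ˣ) : Matrix (Fin 2) (Fin 2) ℂ) - 1‖ ≤ δ') :
    ‖(((axialT (bgUnits F K W) (Site.fibreSite 0 (K - n) (iterBlockOf (K - n) x) fun _ => (⟨0, pow_pos (F.P K).L_pos (K - n)⟩ : Fin ((F.P K).L ^ (K - n)))) (embIter (K - n) Y))⁻¹ *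
          axialT (bgUnits F K W) (Site.fibreSite 0 (K - n) (iterBlockOf (K - n) x) fun _ => (⟨0, pow_pos (F.P K).L_pos (K - n)⟩ : Fin ((F.P K).L ^ (K - n)))) x : (Matrix (Fin 2) (Fin 2) ℂ)ˣ) : Matrix (Fin 2) (Fin 2) ℂ) - 1‖ ≤ 8 * m * δ' := by
  have hA : axialT (bgUnits F K W) (Site.fibreSite 0 (K - n) (iterBlockOf (K - n) x) fun _ => (⟨0, pow_pos (F.P K).L_pos (K - n)⟩ : Fin ((F.P K).L ^ (K - n)))) (embIter (K - n) Y) ∈ U1 (Matrix (Fin 2) (Fin 2) ℂ) :=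
    holT_mem_U1 (fun b => unitsField_toUField_mem_U1' W b) _ _
  have h1 := norm_axialT_bgUnits_sub_one_le F W (Site.fibreSite 0 (K - n) (iterBlockOf (K - n) x) fun _ => (⟨0, pow_pos (F.P K).L_pos (K - n)⟩ : Fin ((F.P K).L ^ (K - n)))) (embIter (K - n) Y) hδ hm1 hmδ hlen1 hw1
  have h2 := norm_axialT_bgUnits_sub_one_le F W (Site.fibreSite 0 (K - n) (iterBlockOf (K - n) x) fun _ => (⟨0, pow_pos (F.P K).L_pos (K - n)⟩ : Fin ((F.P K).L ^ (K - n)))) x hδ hm1 hmδ hlen2 hw2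
  calc _ ≤ _ := norm_inv_mul_sub_one_le hA
    _ ≤ 4 * m * δ' + 4 * m * δ' := add_le_add h1 h2
    _ = 8 * m * δ' := by ring

/-- ★★ **THE CURVED FRAME ROW IN THE CONSUMED SHAPE**: if on every block `Y` meeting `supp χ` and every `x ∈ B(Y)` the two comb walks are `δ′`-flat for `W♭` (lengths `≤ m`, `4mδ′ ≤ 1`),
then the hypothesis `hCU` of ✓`Prop7TopMeanTwoBackgrounds.norm_lift_topMean_sub_le`∕`norm_inner_lift_topMean_sub_le` holds with `δ_U := 8mδ′`.
[cite: Balaban1985Averaging, (19)-(20) p.21, p.24; Balaban1985BackgroundPropagators, (3.19) p.393] -/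
theorem frameRow_of_walkFlat (W : GaugeField (F.P K) 0 (Matrix.specialUnitaryGroup (Fin 2) ℂ)) (χ : Site (F.P K) 0 → ℝ)
    {δ' : ℝ} (hδ : 0 ≤ δ') {m : ℕ} (hm1 : 1 ≤ m) (hmδ : 4 * (m : ℝ) * δ' ≤ 1)
    (hlen : ∀ Y : Site (F.P K) (K - n), (∃ x ∈ iterBlock (K - n) Y, χ x ≠ 0) → ∀ x ∈ iterBlock (K - n) Y,
      l1 (rel (Site.fibreSite 0 (K - n) (iterBlockOf (K - n) x) fun _ => (⟨0, pow_pos (F.P K).L_pos (K - n)⟩ : Fin ((F.P K).L ^ (K - n)))) (embIter (K - n) Y)) ≤ m ∧ l1 (rel (Site.fibreSite 0 (K - n) (iterBlockOf (K - n) x) fun _ => (⟨0, pow_pos (F.P K).L_pos (K - n)⟩ : Fin ((F.P K).L ^ (K - n)))) x) ≤ m)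
    (hw : ∀ Y : Site (F.P K) (K - n), (∃ x ∈ iterBlock (K - n) Y, χ x ≠ 0) → ∀ x ∈ iterBlock (K - n) Y,
      (∀ st ∈ walk (Site.fibreSite 0 (K - n) (iterBlockOf (K - n) x) fun _ => (⟨0, pow_pos (F.P K).L_pos (K - n)⟩ : Fin ((F.P K).L ^ (K - n)))) (treeWord (rel (Site.fibreSite 0 (K - n) (iterBlockOf (K - n) x) fun _ => (⟨0, pow_pos (F.P K).L_pos (K - n)⟩ : Fin ((F.P K).L ^ (K - n)))) (embIter (K - n) Y))), ‖((bgUnits F K W st.bond : (Matrix (Fin 2) (Fin 2) ℂ)ˣ) : Matrix (Fin 2) (Fin 2) ℂ) - 1‖ ≤ δ') ∧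
      (∀ st ∈ walk (Site.fibreSite 0 (K - n) (iterBlockOf (K - n) x) fun _ => (⟨0, pow_pos (F.P K).L_pos (K - n)⟩ : Fin ((F.P K).L ^ (K - n)))) (treeWord (rel (Site.fibreSite 0 (K - n) (iterBlockOf (K - n) x) fun _ => (⟨0, pow_pos (F.P K).L_pos (K - n)⟩ : Fin ((F.P K).L ^ (K - n)))) x)), ‖((bgUnits F K W st.bond : (Matrix (Fin 2) (Fin 2) ℂ)ˣ) : Matrix (Fin 2) (Fin 2) ℂ) - 1‖ ≤ δ')) :
    ∀ Y : Site (F.P K) (K - n), (∃ x ∈ iterBlock (K - n) Y, χ x ≠ 0) → ∀ x ∈ iterBlock (K - n) Y,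
      ‖(((axialT (bgUnits F K W) (Site.fibreSite 0 (K - n) (iterBlockOf (K - n) x) fun _ => (⟨0, pow_pos (F.P K).L_pos (K - n)⟩ : Fin ((F.P K).L ^ (K - n)))) (embIter (K - n) Y))⁻¹ *
          axialT (bgUnits F K W) (Site.fibreSite 0 (K - n) (iterBlockOf (K - n) x) fun _ => (⟨0, pow_pos (F.P K).L_pos (K - n)⟩ : Fin ((F.P K).L ^ (K - n)))) x : (Matrix (Fin 2) (Fin 2) ℂ)ˣ) : Matrix (Fin 2) (Fin 2) ℂ) - 1‖ ≤ 8 * m * δ' :=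
  fun Y hY x hx => norm_frame_sub_one_le F W Y x hδ hm1 hmδ (hlen Y hY x hx).1 (hlen Y hY x hx).2 (hw Y hY x hx).1 (hw Y hY x hx).2

end Summit.QuantumFields.YangMills.Theorems.Prop7TopMeanFrameRows
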